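import Summits.BirchSwinnertonDyer.Rank1Residual.Additive.TameBranchGaussShift
import HarnessLib

/-!
# Class N10, tame branch: the `p`-th power DESCENT of a character of `Γ` (conductor `p^{m+1}` →
# conductor `p^m`, same wild additive character) and the `j`-th power TWIST (same conductor, wild
# character shifted by `j`) — character bookkeeping for the TUPLE RIGIDITY of the E-normalised tame
# branch (cell `b2b-bsdres`, sub-cell additive-p2, gen 21; file 1 of 2, see `TameBranchRigidity.lean`)

HONEST FRAMING (cell `b2b-bsdres`, run/shared/lean/b2b/bsd-rank1-residual/, verbatim in every
file): the goal of the cell is to DELETE the COMBINATION-SHAPED residual classes of the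
Birch–Swinnerton-Dyer formula for ALL analytic-rank `≤ 1` elliptic curves over `ℚ` — "full BSD
formula for every rank `≤ 1` curve in class `C`" assembled STRICTLY from published theorems — so
that the rank-`≤ 1` remainder becomes exactly the CONSTRUCTION-SHAPED classes, which are TYPED
(missing-input `Prop`s), NOT attempted. This is not "finishing BSD". Research route on the
CONSTRUCTION-SHAPED classes X3♯(G-ord)/X4♯(G-ord) (sub-cell additive-p2, gen 21); THEOREMS ONLY —
no definition, no named fact, no conjecture node; labels / RESIDUAL-MAP marks UNCHANGED; nothing
booked.

## What and why

The interpolation package `IsTameBranchOf f p ε α B` (`TameBranchLower.lean` §1) prescribes the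
values of `B` at `κ(γ) − 1` for the characters `κ` of `Γ` of conductor `p^m`, `m ≥ 2`, with the
constant `α^{−m} p^{−1} τ(ε, ψ_κ)`, `ψ_κ(t) = κ(1 + t p^{m−1})` the wild additive character
(`wildAddChar`, `TameBranchWildCharacter.lean`). Two elementary operations on such `κ` drive the
tuple-rigidity argument of `TameBranchRigidity.lean`:

* **DESCENT** (`exists_pow_prime_descent`, `p` odd, `m ≥ 2`): for `κ` primitive of conductor
  `p^{m+1}`, even, of `p`-power order, the character `κ^p` factors through `p^m`
  (`(1 + y p^m)^p ≡ 1 (mod p^{m+1})`), and the descended character `κ₁` mod `p^m` is primitive,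
  even, of `p`-power order, with `κ₁(γ) = κ(γ)^p` — so `κ₁(γ) − 1 = (1 + (κ(γ) − 1))^p − 1` is the
  image of `κ(γ) − 1` under the `p`-power map `T ↦ (1+T)^p − 1` — and with the SAME wild additive
  character, `ψ_{κ₁} = ψ_κ` (`(1 + t p^{m−1})^p ≡ 1 + t p^m (mod p^{m+1})`, `p` odd, `m ≥ 2`), hence the
  same intrinsic Gauss sums `τ(ε, ψ_{κ₁}) = τ(ε, ψ_κ)` for every `ε`.
* **TWIST** (`wildAddChar_pow`, `isPrimitive_pow_of_not_dvd`): for `p ∤ j`, `κ^j` is again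
  primitive, even, of `p`-power order, and `ψ_{κ^j} = ψ_κ(j ·)`, so
  `ε(j) · τ(ε, ψ_{κ^j}) = τ(ε, ψ_κ)` (Mathlib `gaussSum_mulShift`) — the Gauss sums of the twists
  see EVERY value of `ε`.
* `tameGaussSum_ne_zero`: `τ(ε, ψ_κ) ≠ 0` for `κ` primitive (`= −1` for `ε = 1`, of absolute value
  `√p` otherwise).

References: Washington, GTM 83, §7.2 (characters of `Γ`); Mazur–Tate–Teitelbaum, Invent. Math. 84
(1986) §I.13 [MazurTateTeitelbaum1986Invent]; `TameBranchWildCharacter.lean`,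
`TameBranchGaussShift.lean` (cc-typer-2).
-/

noncomputable section

open scoped Classical

namespace Summit.BirchSwinnertonDyer.Rank1Residual.Additive

open Literature.NumberTheory.EllipticCurves

/-! ### §1 Congruences in `ℤ/p^{m+1}` -/

section Congruences

variable {p : ℕ} [hp : Fact p.Prime] {m : ℕ}

/-- Truncated binomial theorem: `(1 + x)^n = 1 + n x + C(n,2) x²` when `x³ = 0`. [folklore] -/
theorem one_add_pow_eq_of_cube_eq_zero {R : Type*} [CommRing R] {x : R} (hx : x ^ 3 = 0) (n : ℕ) :
    (1 + x) ^ n = 1 + (n : R) * x + (n.choose 2 : R) * x ^ 2 := by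
  induction n with
  | zero => simp
  | succ n ih =>
    have hx3 : (n.choose 2 : R) * x ^ 2 * x = 0 := by
      rw [mul_assoc, ← pow_succ, hx, mul_zero]
    have hc : (n + 1).choose 2 = n + n.choose 2 := by
      simpa using Nat.choose_succ_succ' n 1
    rw [pow_succ, ih, hc, Nat.cast_succ, Nat.cast_add]
    linear_combination hx3

omit hp in
/-- Powers of `p` at least the level vanish in `ℤ/p^L`. [folklore] -/
theorem natCast_prime_pow_eq_zero_of_le {L k : ℕ} (h : L ≤ k) : ((p : ZMod (p ^ L)) ^ k) = 0 := by
  obtain ⟨i, rfl⟩ := Nat.exists_eq_add_of_le h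
  rw [pow_add, ← Nat.cast_pow, ZMod.natCast_self, zero_mul]

omit hp in
/-- **`(1 + y·p^m)^p = 1` in `ℤ/p^{m+1}`** (`m ≥ 1`): the kernel of `(ℤ/p^{m+1})ˣ → (ℤ/p^m)ˣ` is
killed by `p`. [folklore] -/
theorem one_add_mul_pow_pow_prime_eq_one (hm : 1 ≤ m) (y : ZMod (p ^ (m + 1))) :
    (1 + y * (p : ZMod (p ^ (m + 1))) ^ m) ^ p = 1 := by
  have hx2 : (y * (p : ZMod (p ^ (m + 1))) ^ m) ^ 2 = 0 := by
    rw [mul_pow, ← pow_mul, natCast_prime_pow_eq_zero_of_le (by omega), mul_zero]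
  have hx3 : (y * (p : ZMod (p ^ (m + 1))) ^ m) ^ 3 = 0 := by
    rw [pow_succ (y * (p : ZMod (p ^ (m + 1))) ^ m) 2, hx2, zero_mul]
  have hpx : (p : ZMod (p ^ (m + 1))) * (y * (p : ZMod (p ^ (m + 1))) ^ m) = 0 := by
    rw [mul_left_comm, ← pow_succ', natCast_prime_pow_eq_zero_of_le le_rfl, mul_zero]
  rw [one_add_pow_eq_of_cube_eq_zero hx3, hx2, mul_zero, add_zero, hpx, add_zero]

/-- **`(1 + y·p^{m−1})^p = 1 + y·p^m` in `ℤ/p^{m+1}`** for `p` ODD and `m ≥ 2` (the middle binomial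
coefficient `C(p,2)` is divisible by `p`). [folklore] -/
theorem one_add_mul_pow_pred_pow_prime (hp2 : p ≠ 2) (hm : 2 ≤ m) (y : ZMod (p ^ (m + 1))) :
    (1 + y * (p : ZMod (p ^ (m + 1))) ^ (m - 1)) ^ p =
      1 + y * (p : ZMod (p ^ (m + 1))) ^ m := by
  have hx3 : (y * (p : ZMod (p ^ (m + 1))) ^ (m - 1)) ^ 3 = 0 := by
    rw [mul_pow, ← pow_mul, natCast_prime_pow_eq_zero_of_le (by omega), mul_zero]
  have h2p : 2 < p := lt_of_le_of_ne hp.out.two_le (Ne.symm hp2)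
  obtain ⟨c, hc⟩ := hp.out.dvd_choose_self (k := 2) two_ne_zero h2p
  rw [one_add_pow_eq_of_cube_eq_zero hx3, hc, Nat.cast_mul]
  have h1 : (p : ZMod (p ^ (m + 1))) * (y * (p : ZMod (p ^ (m + 1))) ^ (m - 1)) =
      y * (p : ZMod (p ^ (m + 1))) ^ m := by
    rw [mul_left_comm, ← pow_succ', Nat.sub_add_cancel (by omega)]
  have h2 : (p : ZMod (p ^ (m + 1))) * (c : ZMod (p ^ (m + 1))) *
      (y * (p : ZMod (p ^ (m + 1))) ^ (m - 1)) ^ 2 = 0 := by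
    have h3 : (p : ZMod (p ^ (m + 1))) ^ ((m - 1) * 2 + 1) = 0 :=
      natCast_prime_pow_eq_zero_of_le (by omega)
    calc (p : ZMod (p ^ (m + 1))) * (c : ZMod (p ^ (m + 1))) *
          (y * (p : ZMod (p ^ (m + 1))) ^ (m - 1)) ^ 2
        = (c : ZMod (p ^ (m + 1))) * y ^ 2 * (p : ZMod (p ^ (m + 1))) ^ ((m - 1) * 2 + 1) := by
          ring
      _ = 0 := by rw [h3, mul_zero]
  rw [h1, h2, add_zero]

/-- `1 + t·p^k` is a unit of `ℤ/p^L` when `1 ≤ k` (it is `1` mod `p`). [folklore] -/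
theorem isUnit_one_add_mul_prime_pow {L k : ℕ} (hL : 1 ≤ L) (hk : 1 ≤ k) (y : ZMod (p ^ L)) :
    IsUnit (1 + y * (p : ZMod (p ^ L)) ^ k) := by
  rw [isUnit_iff_isUnit_cast hL, map_add, map_one, map_mul, map_pow, map_natCast,
    ZMod.natCast_self, zero_pow (by omega), mul_zero, add_zero]
  exact isUnit_one

end Congruences

/-! ### §2 Primitivity at prime-power level -/

section Primitive

variable {p : ℕ} [hp : Fact p.Prime] {R : Type*} [CommMonoidWithZero R]

/-- A character mod `p^m` (`m ≥ 1`) which is NOT primitive factors through `p^{m−1}` (its conductor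
is `p^c` with `c < m`). [folklore] -/
theorem factorsThrough_pow_pred_of_not_isPrimitive {m : ℕ} (χ : DirichletCharacter R (p ^ m))
    (hχ : ¬ χ.IsPrimitive) : χ.FactorsThrough (p ^ (m - 1)) := by
  haveI : NeZero (p ^ m) := ⟨pow_ne_zero m hp.out.ne_zero⟩
  rw [DirichletCharacter.isPrimitive_def] at hχ
  obtain ⟨c, hc, hcond⟩ := (Nat.dvd_prime_pow hp.out).mp χ.conductor_dvd_level
  have hclt : c < m := lt_of_le_of_ne hc (fun h ↦ hχ (by rw [hcond, h]))
  have hdvd : χ.conductor ∣ p ^ (m - 1) := by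
    rw [hcond]
    exact pow_dvd_pow p (by omega)
  exact (DirichletCharacter.mem_conductorSet_iff_conductor_dvd χ
    (pow_dvd_pow p (Nat.sub_le m 1))).mpr hdvd

/-- If `χ` mod `p^m` factors through `p^{m−1}` (`m ≥ 2`), its wild additive character
`t ↦ χ(1 + t p^{m−1})` is trivial (`1 + t p^{m−1}` lies in the kernel of
`(ℤ/p^m)ˣ → (ℤ/p^{m−1})ˣ`). [folklore] -/
theorem wildAddChar_eq_one_of_factorsThrough {m : ℕ} (hm : 2 ≤ m)
    {χ : DirichletCharacter ℂ_[p] (p ^ m)} (hχ : χ.FactorsThrough (p ^ (m - 1))) :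
    wildAddChar hm χ = 1 := by
  haveI : NeZero (p ^ m) := ⟨pow_ne_zero m hp.out.ne_zero⟩
  have hker := (DirichletCharacter.factorsThrough_iff_ker_unitsMap
    (pow_dvd_pow p (Nat.sub_le m 1))).mp hχ
  ext t
  rw [wildAddChar_apply, AddChar.one_apply]
  have hu := isUnit_one_add_mul_prime_pow (p := p) (by omega : 1 ≤ m) (by omega : 1 ≤ m - 1)
    ((t.val : ℕ) : ZMod (p ^ m))
  have hmem : hu.unit ∈ (ZMod.unitsMap (pow_dvd_pow p (Nat.sub_le m 1))).ker := by
    rw [MonoidHom.mem_ker]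
    ext
    rw [ZMod.unitsMap_def, Units.coe_map, IsUnit.unit_spec, Units.val_one, MonoidHom.coe_coe,
      map_add, map_one, map_mul, map_pow, map_natCast, map_natCast, ← Nat.cast_pow,
      ZMod.natCast_self, mul_zero, add_zero]
  have h1 := hker hmem
  rw [MonoidHom.mem_ker] at h1
  have h2 := congr_arg Units.val h1
  rwa [MulChar.coe_toUnitHom, IsUnit.unit_spec, Units.val_one] at h2

end Primitive

/-! ### §3 The `p`-th power descent -/

section Descent

variable {p : ℕ} [hp : Fact p.Prime] {m : ℕ}

/-- **The `p`-th power DESCENT of a character of `Γ`.** Let `p` be odd, `m ≥ 2`, and `κ` a primitive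
Dirichlet character mod `p^{m+1}` with values in `ℂ_p`, even and of `p`-power order. Then there is
a PRIMITIVE character `κ₁` mod `p^m`, even and of `p`-power order (the descent of `κ^p`), with
`κ₁(γ) = κ(γ)^p` at the cyclotomic generator `γ = 1 + p` and with the SAME wild additive character
`ψ_{κ₁} = ψ_κ` — so the same intrinsic Gauss sums `τ(ε, ψ_{κ₁}) = τ(ε, ψ_κ)`. (Washington §7.2: the
characters of `Γ` of conductor `p^{m+1}` are the `κ` with `κ(γ)` of order exactly `p^m`; the
`p`-th power has conductor `p^m`.) [folklore] -/
theorem exists_pow_prime_descent (hp2 : p ≠ 2) (hm : 2 ≤ m)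
    (κ : DirichletCharacter ℂ_[p] (p ^ (m + 1))) (hκ : κ.IsPrimitive) (heven : κ.Even)
    (hord : ∃ j : ℕ, orderOf κ = p ^ j) :
    ∃ κ₁ : DirichletCharacter ℂ_[p] (p ^ m), κ₁.IsPrimitive ∧ κ₁.Even ∧
      (∃ j : ℕ, orderOf κ₁ = p ^ j) ∧
      κ₁ (cyclotomicGenerator p : ZMod (p ^ m)) =
        κ (cyclotomicGenerator p : ZMod (p ^ (m + 1))) ^ p ∧
      wildAddChar hm κ₁ = wildAddChar (by omega : 2 ≤ m + 1) κ := by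
  haveI : NeZero (p ^ (m + 1)) := ⟨pow_ne_zero _ hp.out.ne_zero⟩
  haveI : NeZero (p ^ m) := ⟨pow_ne_zero _ hp.out.ne_zero⟩
  have hdvd : p ^ m ∣ p ^ (m + 1) := pow_dvd_pow p m.le_succ
  -- `κ^p` factors through `p^m`
  have hfac : (κ ^ p).FactorsThrough (p ^ m) := by
    rw [DirichletCharacter.factorsThrough_iff_ker_unitsMap hdvd, SetLike.le_def]
    intro u hu
    rw [MonoidHom.mem_ker] at hu ⊢
    have hcast : ZMod.castHom hdvd (ZMod (p ^ m)) (u : ZMod (p ^ (m + 1))) = 1 := by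
      have h := congr_arg Units.val hu
      rwa [ZMod.unitsMap_def, Units.coe_map, Units.val_one] at h
    obtain ⟨y, hy⟩ := exists_eq_one_add_mul_pow_pred (p := p) (m := m + 1) hcast
    ext
    rw [MulChar.coe_toUnitHom, MulChar.pow_apply_coe, ← map_pow, hy, Nat.add_sub_cancel,
      one_add_mul_pow_pow_prime_eq_one (by omega), map_one, Units.val_one]
  set κ₁ := hfac.χ₀ with hκ₁_def
  have hκ₁ : κ ^ p = DirichletCharacter.changeLevel hdvd κ₁ := hfac.eq_changeLevel
  -- values on units
  have hval : ∀ u : (ZMod (p ^ (m + 1)))ˣ,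
      κ₁ (ZMod.castHom hdvd (ZMod (p ^ m)) (u : ZMod (p ^ (m + 1)))) =
        κ (u : ZMod (p ^ (m + 1))) ^ p := fun u ↦ by
    rw [ZMod.castHom_apply, ← DirichletCharacter.changeLevel_eq_cast_of_dvd κ₁ hdvd, ← hκ₁,
      MulChar.pow_apply_coe]
  -- the wild additive characters agree
  have hwild : wildAddChar hm κ₁ = wildAddChar (by omega : 2 ≤ m + 1) κ := by
    ext t
    rw [wildAddChar_apply, wildAddChar_apply, Nat.add_sub_cancel]
    have hu := isUnit_one_add_mul_prime_pow (p := p) (by omega : 1 ≤ m + 1)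
      (by omega : 1 ≤ m - 1) ((t.val : ℕ) : ZMod (p ^ (m + 1)))
    have h := hval hu.unit
    rw [IsUnit.unit_spec, map_add, map_one, map_mul, map_pow, map_natCast, map_natCast, ← map_pow,
      one_add_mul_pow_pred_pow_prime hp2 hm] at h
    exact h
  refine ⟨κ₁, ?_, ?_, ?_, ?_, hwild⟩
  · -- primitive: otherwise `ψ_{κ₁} = 1`, but `ψ_{κ₁} = ψ_κ ≠ 1`
    by_contra hprim
    have h1 := wildAddChar_eq_one_of_factorsThrough hm
      (factorsThrough_pow_pred_of_not_isPrimitive κ₁ hprim)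
    rw [hwild] at h1
    exact wildAddChar_ne_one (by omega : 2 ≤ m + 1) hκ h1
  · -- even
    have h := hval (-1)
    rw [Units.val_neg, Units.val_one, map_neg, map_one, heven, one_pow] at h
    exact h
  · -- `p`-power order
    obtain ⟨j, hj⟩ := hord
    have hord1 : orderOf κ₁ = orderOf (κ ^ p) := by
      rw [hκ₁, orderOf_injective (DirichletCharacter.changeLevel hdvd)
        (DirichletCharacter.changeLevel_injective hdvd)]
    have hdvd' : orderOf κ₁ ∣ p ^ j := by
      rw [hord1, ← hj]
      exact orderOf_pow_dvd p
    obtain ⟨i, -, hi⟩ := (Nat.dvd_prime_pow hp.out).mp hdvd'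
    exact ⟨i, hi⟩
  · -- value at `γ`
    obtain ⟨v, hv⟩ := isUnit_cyclotomicGenerator_cast p (m + 1)
    have h := hval v
    rw [hv, map_natCast] at h
    exact h

/-- The descended character has the same intrinsic Gauss sums. [folklore] -/
theorem tameGaussSum_eq_of_wildAddChar_eq {m m' : ℕ} (hm : 2 ≤ m) (hm' : 2 ≤ m')
    {κ₁ : DirichletCharacter ℂ_[p] (p ^ m)} {κ : DirichletCharacter ℂ_[p] (p ^ m')}
    (h : wildAddChar hm κ₁ = wildAddChar hm' κ) (ε : DirichletCharacter ℂ_[p] p) :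
    tameGaussSum p ε κ₁ = tameGaussSum p ε κ := by
  rw [tameGaussSum_eq_gaussSum hm, tameGaussSum_eq_gaussSum hm', h]

end Descent

/-! ### §4 Twisting by `j`-th powers; non-vanishing of the intrinsic Gauss sum -/

section Twist

variable {p : ℕ} [hp : Fact p.Prime] {m : ℕ}

/-- `ψ_{κ^j} = ψ_κ(j ·)`: the wild additive character of a power is the shifted wild character.
[folklore] -/
theorem wildAddChar_pow (hm : 2 ≤ m) (κ : DirichletCharacter ℂ_[p] (p ^ m)) (j : ℕ) :
    wildAddChar hm (κ ^ j) = (wildAddChar hm κ).mulShift (j : ZMod p) := by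
  ext t
  have hu := isUnit_one_add_mul_prime_pow (p := p) (by omega : 1 ≤ m) (by omega : 1 ≤ m - 1)
    ((t.val : ℕ) : ZMod (p ^ m))
  rw [AddChar.mulShift_apply, wildAddChar_apply, ← hu.unit_spec, MulChar.pow_apply_coe,
    hu.unit_spec, ← wildAddChar_apply hm, ← AddChar.map_nsmul_eq_pow, nsmul_eq_mul]

/-- A power `κ^j` with `p ∤ j` of a primitive character mod `p^m` (`m ≥ 2`) is primitive: its wild
additive character `ψ_κ(j ·)` is still non-trivial. [folklore] -/
theorem isPrimitive_pow_of_not_dvd (hm : 2 ≤ m) {κ : DirichletCharacter ℂ_[p] (p ^ m)}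
    (hκ : κ.IsPrimitive) {j : ℕ} (hj : ¬ p ∣ j) : (κ ^ j).IsPrimitive := by
  by_contra hprim
  have h1 := wildAddChar_eq_one_of_factorsThrough hm
    (factorsThrough_pow_pred_of_not_isPrimitive (κ ^ j) hprim)
  rw [wildAddChar_pow] at h1
  have hj0 : (j : ZMod p) ≠ 0 := by rwa [Ne, ZMod.natCast_eq_zero_iff]
  exact (isPrimitive_wildAddChar hm hκ) hj0 h1

/-- Powers of an even character are even. [folklore] -/
theorem even_pow {n : ℕ} {κ : DirichletCharacter ℂ_[p] n} (heven : κ.Even) (j : ℕ) :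
    (κ ^ j).Even := by
  have h : (κ ^ j) ((-1 : (ZMod n)ˣ) : ZMod n) = κ ((-1 : (ZMod n)ˣ) : ZMod n) ^ j :=
    MulChar.pow_apply_coe κ j (-1)
  rw [Units.val_neg, Units.val_one] at h
  rw [DirichletCharacter.Even, h, heven, one_pow]

/-- Powers of a character of `p`-power order have `p`-power order. [folklore] -/
theorem exists_orderOf_pow_eq_prime_pow {n : ℕ} {κ : DirichletCharacter ℂ_[p] n}
    (hord : ∃ i : ℕ, orderOf κ = p ^ i) (j : ℕ) : ∃ i : ℕ, orderOf (κ ^ j) = p ^ i := by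
  obtain ⟨i, hi⟩ := hord
  have hdvd : orderOf (κ ^ j) ∣ p ^ i := hi ▸ orderOf_pow_dvd j
  obtain ⟨i', -, hi'⟩ := (Nat.dvd_prime_pow hp.out).mp hdvd
  exact ⟨i', hi'⟩

/-- **`ε(j) · τ(ε, ψ_{κ^j}) = τ(ε, ψ_κ)`** for `p ∤ j` (Mathlib `gaussSum_mulShift`): the Gauss sums
of the twists `κ^j` differ from `τ(ε, ψ_κ)` exactly by the values of `ε̄`. [folklore] -/
theorem apply_mul_tameGaussSum_pow (hm : 2 ≤ m) (κ : DirichletCharacter ℂ_[p] (p ^ m))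
    (ε : DirichletCharacter ℂ_[p] p) (u : (ZMod p)ˣ) :
    ε u * tameGaussSum p ε (κ ^ (u : ZMod p).val) = tameGaussSum p ε κ := by
  rw [tameGaussSum_eq_gaussSum hm, tameGaussSum_eq_gaussSum hm, wildAddChar_pow,
    ZMod.natCast_zmod_val, gaussSum_mulShift]

/-- **The intrinsic Gauss sum does not vanish**: `τ(ε, ψ_κ) ≠ 0` for `κ` primitive mod `p^m`,
`m ≥ 2` (`τ(1, ψ_κ) = −1`; `τ(ε,ψ_κ) τ(ε̄,ψ_κ) = ε(−1) p` for `ε ≠ 1`). [folklore] -/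
theorem tameGaussSum_ne_zero (hm : 2 ≤ m) {κ : DirichletCharacter ℂ_[p] (p ^ m)}
    (hκ : κ.IsPrimitive) (ε : DirichletCharacter ℂ_[p] p) : tameGaussSum p ε κ ≠ 0 := by
  by_cases hε : ε = 1
  · rw [hε, tameGaussSum_eq_gaussSum hm, gaussSum_one_left (wildAddChar_ne_one hm hκ)]
    exact neg_ne_zero.mpr one_ne_zero
  · intro h0
    have h := tameGaussSum_mul_tameGaussSum_inv hm hε hκ
    rw [h0, zero_mul] at h
    have hε1 : ε (-1) ≠ 0 := by
      intro h1
      have h2 := apply_neg_one_mul_apply_neg_one ε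
      rw [h1, zero_mul] at h2
      exact zero_ne_one h2
    exact mul_ne_zero hε1 (Nat.cast_ne_zero.mpr hp.out.ne_zero) h.symm

end Twist

end Summit.BirchSwinnertonDyer.Rank1Residual.Additive

end
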